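import Summits.HubbardSuperconductivity.HubbardSuperconductivity.Theses.PlaquetteBoson
import Summits.HubbardSuperconductivity.HubbardSuperconductivity.Theorems.PolyaSchurPairBosonSectorPerronXXZ

/-!
# Route `PlaquetteBoson`, support `PbInterpolation` (stmt-HubbardSuperconductivity-0908)

`PbMonotoneDepletion → PbHalfFilledXYOrder → ` condensation at every boson filling `ρ ∈ (0, 1/2]`:
for `Δ ∈ (−1, 0]` and `ρ ∈ (0, 1/2]` there are `c > 0`, `M₀` such that for every even `M ≥ M₀`,
every `N` with `ρ M² ≤ N ≤ M²/2` and every normalised `N`-boson sector ground state `ψ` of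
`xxzHamiltonian 1 (torusGraph 2 M) (−1) Δ` one has `⟨ψ, S⁺_tot S⁻_tot ψ⟩ ≥ c M⁴`.

Proof (the interpolation of the card): write `Λ(N)` for the condensate of a normalised sector
ground state with `N` bosons (sector `S^z_tot = N − M²/2`). Monotone depletion says
`(N+1) Λ(N) ≥ N Λ(N+1)` for `1 ≤ N < M²/2`, so `Λ(N)/N` is nonincreasing and, chaining down from
half filling `K = M²/2` where `Λ(K) ≥ c_HF M⁴ = K · 2 c_HF M²`, every `1 ≤ N ≤ K` has
`Λ(N) ≥ N · 2 c_HF M² ≥ 2 ρ c_HF M⁴`. The chain needs a normalised ground state in every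
intermediate sector; it exists by Perron–Frobenius in the sector (`sectorPerronXXZ_proof`,
Theorems/PolyaSchurPairBosonSectorPerronXXZ.lean) and normalisation. Constants: `c := 2 ρ c_HF`,
`M₀ := max (M₀^{MD}, M₀^{HF}, 2)`.

Sources: T. Kennedy, E. H. Lieb, B. S. Shastry, PRL 61 (1988) 2582 (half-filled anchor, context);
H. Tasaki (2020) §2.4 (Perron–Frobenius in sectors). No definition is introduced.
-/

set_option linter.dupNamespace false

noncomputable section

namespace Summit.HubbardSuperconductivity.HubbardSuperconductivity.Theorems.PlaquetteBoson

open scoped BigOperators Matrix ComplexOrder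
open Matrix Complex Finset
open Literature.MathematicalPhysics.QuantumLattice Literature.Probability.LatticeModels
open Summit.HubbardSuperconductivity.HubbardSuperconductivity.Theses.PlaquetteBoson

/-- Normalisation of a nonzero complex vector: `ψ/‖ψ‖` has `⟨ψ/‖ψ‖, ψ/‖ψ‖⟩ = 1`. [folklore] -/
private theorem exists_smul_unit {ι : Type*} [Fintype ι] {v : ι → ℂ} (hv : v ≠ 0) :
    ∃ c : ℂ, star (c • v) ⬝ᵥ (c • v) = 1 := by
  have hpos : 0 < star v ⬝ᵥ v := dotProduct_star_self_pos_iff.2 hv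
  obtain ⟨r, hr⟩ : ∃ r : ℝ, (star v ⬝ᵥ v) = (r : ℂ) ∧ 0 < r := by
    obtain ⟨hre, him⟩ := Complex.pos_iff.1 hpos
    exact ⟨(star v ⬝ᵥ v).re, (Complex.ext rfl (by simp [him])), hre⟩
  refine ⟨((Real.sqrt r)⁻¹ : ℝ), ?_⟩
  rw [star_smul, smul_dotProduct, dotProduct_smul, smul_smul, hr.1, smul_eq_mul,
    Complex.star_def, Complex.conj_ofReal, ← Complex.ofReal_mul, ← Complex.ofReal_mul]
  rw [← mul_inv, Real.mul_self_sqrt hr.2.le, inv_mul_cancel₀ hr.2.ne']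
  simp

/-- **A normalised ground state exists in every boson-number sector** `S^z_tot = N − M²/2`,
`N ≤ M²`, `M ≥ 2`, of the XXZ torus at any `Δ` (Perron–Frobenius vector of
`sectorPerronXXZ_proof`, normalised). Tasaki (2020) §2.4. [folklore] -/
private theorem exists_unit_sector_groundState (Δ : ℝ) (M : ℕ) [NeZero M] (hM : 2 ≤ M) (N : ℕ)
    (hN : N ≤ M ^ 2) :
    ∃ ψ : TensorIndex (TorusSite 2 M) 2 → ℂ,
      ψ ∈ spinZSector (Λ := TorusSite 2 M) 1 ((N : ℝ) - (M : ℝ) ^ 2 / 2) ∧ star ψ ⬝ᵥ ψ = 1 ∧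
      xxzHamiltonian 1 (torusGraph 2 M) (-1) Δ *ᵥ ψ =
        ((lowestEnergyInSector 1 (xxzHamiltonian 1 (torusGraph 2 M) (-1) Δ)
          ((N : ℝ) - (M : ℝ) ^ 2 / 2) : ℝ) : ℂ) • ψ := by
  obtain ⟨ψ, hψ0, -, hψK, hHψ, -⟩ :=
    Summit.HubbardSuperconductivity.HubbardSuperconductivity.Theorems.PolyaSchurPairBoson.sectorPerronXXZ_proof
      Δ M hM N hN
  obtain ⟨c, hc⟩ := exists_smul_unit hψ0
  exact ⟨c • ψ, Submodule.smul_mem _ c hψK, hc, by rw [mulVec_smul, hHψ, smul_comm]⟩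

/-- **`PbInterpolation` holds** (route `PlaquetteBoson`, item `stmt-HubbardSuperconductivity-0908`):
monotone depletion chains the half-filled floor `c_HF M⁴` down to every filling `ρ ∈ (0, 1/2]`,
`Λ(N) ≥ (N / (M²/2)) · c_HF M⁴ ≥ 2ρ c_HF M⁴`, through normalised ground states of the intermediate
sectors (Perron–Frobenius). Kennedy–Lieb–Shastry (1988) (anchor); Tasaki (2020) §2.4. [folklore] -/
theorem pbInterpolation_proof : PbInterpolation := by
  unfold PbInterpolation PbMonotoneDepletion PbHalfFilledXYOrder
  intro hMD hHF Δ hΔ ρ hρ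
  obtain ⟨M₁, hM₁⟩ := hMD Δ ⟨le_of_lt hΔ.1, hΔ.2⟩
  obtain ⟨cHF, hcHF, M₂, hM₂⟩ := hHF Δ hΔ
  refine ⟨2 * ρ * cHF, by nlinarith [hρ.1], max (max M₁ M₂) 2, ?_⟩
  intro M _ hME hM N hρN hNK ψ hψK hψ1 hHψ
  have hM1 : M₁ ≤ M := le_trans (le_trans (le_max_left _ _) (le_max_left _ _)) hM
  have hM2 : M₂ ≤ M := le_trans (le_trans (le_max_right _ _) (le_max_left _ _)) hM
  have hM3 : 2 ≤ M := le_trans (le_max_right _ _) hM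
  -- abbreviations
  set H : Op (TorusSite 2 M) 2 := xxzHamiltonian 1 (torusGraph 2 M) (-1) Δ with hHdef
  set B : Op (TorusSite 2 M) 2 := (∑ x : TorusSite 2 M, onSite x (spinRaise 1)) *
    (∑ y : TorusSite 2 M, onSite y (spinLower 1)) with hBdef
  -- half filling `K = M²/2`
  obtain ⟨m, hm⟩ := hME
  have hK2 : M ^ 2 = 2 * (2 * m * m) := by rw [hm]; ring
  set K : ℕ := 2 * m * m with hKdef
  have hKreal : ((K : ℕ) : ℝ) = (M : ℝ) ^ 2 / 2 := by
    have : ((M ^ 2 : ℕ) : ℝ) = 2 * (K : ℝ) := by rw [hK2]; push_cast; ring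
    push_cast at this
    linarith
  have hMpos : (0 : ℝ) < (M : ℝ) := by exact_mod_cast Nat.pos_of_ne_zero (NeZero.ne M)
  -- the per-particle floor `Λ(N') ≥ N' · 2 c_HF M²` for `1 ≤ N' ≤ K`, by downward induction
  have hchain : ∀ j : ℕ, j < K → ∀ φ : TensorIndex (TorusSite 2 M) 2 → ℂ,
      φ ∈ spinZSector (Λ := TorusSite 2 M) 1 (((K - j : ℕ) : ℝ) - (M : ℝ) ^ 2 / 2) →
      star φ ⬝ᵥ φ = 1 →
      H *ᵥ φ = ((lowestEnergyInSector 1 H (((K - j : ℕ) : ℝ) - (M : ℝ) ^ 2 / 2) : ℝ) : ℂ) • φ →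
      ((K - j : ℕ) : ℝ) * (2 * cHF * (M : ℝ) ^ 2) ≤ (star φ ⬝ᵥ B *ᵥ φ).re := by
    intro j
    induction j with
    | zero =>
      intro _ φ hφK hφ1 hHφ
      rw [Nat.sub_zero] at hφK hHφ ⊢
      rw [hKreal, sub_self] at hφK hHφ
      have h := hM₂ M ⟨m, hm⟩ hM2 φ hφK hφ1 hHφ
      rw [hKreal]
      nlinarith [h]
    | succ j ih =>
      intro hj φ hφK hφ1 hHφ
      -- a normalised ground state one particle up
      have hKj : K - (j + 1) + 1 = K - j := by omega
      obtain ⟨χ, hχK, hχ1, hHχ⟩ := exists_unit_sector_groundState Δ M hM3 (K - j) (by omega)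
      have ih' := ih (by omega) χ hχK hχ1 hHχ
      -- monotone depletion between `K - (j+1)` and `K - j`
      have h1 : 1 ≤ K - (j + 1) := by omega
      have h2 : 2 * (K - (j + 1) + 1) ≤ M ^ 2 := by rw [hKj, hK2]; omega
      have hcast : ((K - (j + 1) : ℕ) : ℝ) + 1 = ((K - j : ℕ) : ℝ) := by
        rw [← hKj]; push_cast; ring
      have hχK' : χ ∈ spinZSector (Λ := TorusSite 2 M) 1
          (((K - (j + 1) : ℕ) : ℝ) + 1 - (M : ℝ) ^ 2 / 2) := by rwa [hcast]
      have hHχ' : H *ᵥ χ = ((lowestEnergyInSector 1 H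
          (((K - (j + 1) : ℕ) : ℝ) + 1 - (M : ℝ) ^ 2 / 2) : ℝ) : ℂ) • χ := by rwa [hcast]
      have hmono := hM₁ M ⟨m, hm⟩ hM1 (K - (j + 1)) h1 h2 φ χ hφK hφ1 hHφ hχK' hχ1 hHχ'
      -- `(N'+1) Λ(φ) ≥ N' Λ(χ) ≥ N' (N'+1) 2c M²`
      rw [hcast] at hmono
      have hpos : (0 : ℝ) < ((K - j : ℕ) : ℝ) := by exact_mod_cast (show 0 < K - j by omega)
      have key : ((K - j : ℕ) : ℝ) * (((K - (j + 1) : ℕ) : ℝ) * (2 * cHF * (M : ℝ) ^ 2)) ≤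
          ((K - j : ℕ) : ℝ) * (star φ ⬝ᵥ B *ᵥ φ).re := by
        calc ((K - j : ℕ) : ℝ) * (((K - (j + 1) : ℕ) : ℝ) * (2 * cHF * (M : ℝ) ^ 2))
            = ((K - (j + 1) : ℕ) : ℝ) * (((K - j : ℕ) : ℝ) * (2 * cHF * (M : ℝ) ^ 2)) := by ring
          _ ≤ ((K - (j + 1) : ℕ) : ℝ) * (star χ ⬝ᵥ B *ᵥ χ).re :=
            mul_le_mul_of_nonneg_left ih' (Nat.cast_nonneg _)
          _ ≤ ((K - j : ℕ) : ℝ) * (star φ ⬝ᵥ B *ᵥ φ).re := hmono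
      exact le_of_mul_le_mul_left key hpos
  -- apply the chain at `N = K - j`
  have hNK' : N ≤ K := by
    have : 2 * N ≤ 2 * K := by rw [← hK2]; exact hNK
    omega
  have hN1 : 1 ≤ N := by
    have : (0 : ℝ) < (N : ℝ) := lt_of_lt_of_le (mul_pos hρ.1 (by positivity)) hρN
    exact_mod_cast this
  obtain ⟨j, hj, rfl⟩ : ∃ j, j < K ∧ N = K - j := ⟨K - N, by omega, by omega⟩
  have h := hchain j hj ψ hψK hψ1 hHψ
  calc 2 * ρ * cHF * (M : ℝ) ^ 4 = (ρ * (M : ℝ) ^ 2) * (2 * cHF * (M : ℝ) ^ 2) := by ring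
    _ ≤ ((K - j : ℕ) : ℝ) * (2 * cHF * (M : ℝ) ^ 2) :=
        mul_le_mul_of_nonneg_right hρN (by positivity)
    _ ≤ (star ψ ⬝ᵥ B *ᵥ ψ).re := h

end Summit.HubbardSuperconductivity.HubbardSuperconductivity.Theorems.PlaquetteBoson
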